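import Summits.QuantumFields.BalabanUV.T4Continuum.Support.NE3QuadRemainderTower
import Summits.QuantumFields.BalabanUV.T4Continuum.Support.NE3LinearisedAverageSup
import Summits.QuantumFields.BalabanUV.T4Continuum.Support.ReplicationRightInverseBound
import Summits.QuantumFields.BalabanUV.T4Continuum.Support.MinimalActionCompact
import Summits.QuantumFields.BalabanUV.T4Continuum.Support.NE3EnergyVary
import Mathlib.Topology.UniformSpace.UniformApproximation
import HarnessLib

/-!
# NE7PushForwardContinuity — THE DIFFERENTIAL OF BAŁABAN'S AVERAGE DEPENDS CONTINUOUSLY ON THE BACKGROUND: `U ↦ cpush L U ψ (c)` and its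
# tower `U ↦ cpushIter L j U ψ (c)` are continuous on the small-field class (product topology), for every fixed direction `ψ`

Cell `pub-balaban`, rung (B)+1 sub-cell t4, lineage `b2b-balaban-t4-ne7-p1`, generation 67 (CRUX PROVER NE7 #1); hunt (h11), memo
`t4/b2b-balaban-t4-ne7-p1-g67/HUNT-H11-NORMAL-CURRENCY.md` §3 (CRIT-CLOSED), §5(1).  File F17 — the analytic half of the letter (CRIT-CLOSED) of F16
`NE7CritContinuityMethod`: the tangent spaces `T(U) = {ψ : cpushIter L k U ψ = 0}` of the constraint fibres move continuously with `U`.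

THE MECHANISM (no derivative of a derivative is touched).  `cpush L U ψ (c)` is the `s`-derivative at `0` of the relative log-coordinate
`s ↦ log((cavg U)(c)⁻¹·(cavg (U e^{sψ}))(c))`; row NE3's ONE-STEP QUADRATIC REMAINDER [tree] `NE3QuadRemainderTower.norm_relStep_sub_cpush_le`
(`‖relStep L U X − cpush L U X‖ ≤ 2(s∕ρ₀)²` for `‖X‖ ≤ s ≤ ρ₀∕4`, UNIFORM over the class) says the difference quotient at step `h` is within
`2h·s²∕ρ₀²` of `cpush L U ψ`, UNIFORMLY IN `U`; each difference quotient is continuous in `U` on the class (the average is, [tree]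
`MinimalActionCompact.continuousOn_rescale_bavg`; the logarithm is analytic in the ball, [tree] `MatrixLog.analyticAt_mlog`; the relative unit stays
within `1∕4` of `1`, [tree] `norm_relUnit_sub_one_le_quarter`); a uniform limit of continuous functions is continuous
(`continuousOn_of_uniform_approx_of_continuousOn`).  The tower follows by induction with the one-level sup bound §2 and linearity
([tree] `ReplicationRightInverse.cpushIter_sub`).  Everything is stated for PARAMETRISED families `p ↦ (V p, ψ p)` (backgrounds continuous into the
product topology, directions coordinatewise continuous, uniformly bounded, skew) so that the induction closes.

WHAT ([folklore]; 0 def, 0 sorry).  §1 `continuous_expUnit`, `continuousOn_vary_param`, `isSkewDir_smul`; §2 `norm_cpush_le_sup` — the one-level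
sup bound `‖cpush L U ψ (c)‖ ≤ (64(d+1)L + L)·sup‖ψ‖` on the class (`512(d+1)(d+4)L²a ≤ 1`; [tree] `norm_sideDeriv_sub_lin_le`, `norm_dhol_le`);
§3 **`continuousOn_cpush_param`** — one level; §4 **`continuousOn_cpushIter_param`** — the tower under `LevelSmall d L j x`, and the plain corollary
`continuousOn_cpushIter` for a fixed skew bounded direction.
HONEST FRAMING (page 1).  Kinematics of the averaging map on OUR frame; nothing about minimisers; NOT CRIT-ONE-STEP, NOT NE7; spine 0∕9; finite T⁴
rung (B)+1 — NOT infinite volume, NOT mass gap, NOT Clay.  Continuum YM on T⁴ ⇐ BetaPertH ∧ nine spine estimates (0/9 proved); BetaPertH ⇐ (D1) ∧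
(D4) ∧ CAP+tail; G-an2-4 gates asym, D1 and NE2/3/4.
-/

set_option autoImplicit false

open scoped BigOperators Matrix Matrix.Norms.L2Operator Topology Uniformity
open NormedSpace Finset Set Filter

namespace Summit.QuantumFields.BalabanUV.T4Continuum.NE7PushForwardContinuity

open Literature.MathematicalPhysics.QuantumFieldTheory.Balaban1983to89
open B7Prop1Explicit B7Prop2Explicit MatrixLog UnitaryModel
open T4AveragingDeficitWall (IsUnitaryCfg IsSkewDir SmallField vary Ad)
open AveragingDeficitTransport (lnorm norm_dhol_le norm_Ad_of_unitary)
open AveragingDeficitChartCalculus (cavg)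
open AveragingDeficitPlaqDeriv (vary_isUnitaryCfg)
open AveragingDeficitTwoLevelPrep (prop1Radius)
open AveragingDeficitMultiLevelPrep (cpush LevelSmall)
open AveragingDeficitResidualPairing (pushDir)
open AveragingDeficitPushForwardLinear (pushDir_smul)
open AveragingDeficitSideDeriv (sideDeriv loopAvg loopWord length_loopWord norm_sideDeriv_sub_lin_le)
open BlockAverageVaryDisc (rho0 rho0_pos)
open NE3QuadRemainderTower (relStep norm_relStep_sub_cpush_le norm_relUnit_sub_one_le_quarter)
open NE3TangentCovariantStructure (norm_Wcx_sub_one_le_32)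
open NE3LinearisedAverageSup (lnorm_le_length_mul)
open NE3EnergyVary (smallField_vary)
open ReplicationRightInverse (cpushIter cpushIter_sub next_level small512_of_levelSmall)
open MinimalActionCompact (continuous_eval continuousOn_rescale_bavg)

noncomputable section

variable {d : ℕ} {n : Type*} [Fintype n] [DecidableEq n]

/-! ## §1 Elementary continuity: the exponential unit and the perturbed configuration of a parametrised family -/

/-- `X ↦ e^X` is continuous as a map into the units (value `e^X`, inverse `e^{−X}`). [folklore] -/
theorem continuous_expUnit : Continuous (expUnit : Matrix n n ℂ → (Matrix n n ℂ)ˣ) := by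
  letI : NormedAlgebra ℚ (Matrix n n ℂ) := NormedAlgebra.restrictScalars ℚ ℂ (Matrix n n ℂ)
  refine Units.continuous_iff.mpr ⟨?_, ?_⟩
  · simpa only [Function.comp_def, val_expUnit] using (NormedSpace.exp_continuous : Continuous (exp : Matrix n n ℂ → Matrix n n ℂ))
  · simp only [val_inv_expUnit, val_expUnit]
    exact (NormedSpace.exp_continuous : Continuous (exp : Matrix n n ℂ → Matrix n n ℂ)).comp continuous_neg

omit [Fintype n] [DecidableEq n] in
/-- A real multiple of a skew direction field is skew. [folklore] -/
theorem isSkewDir_smul (h : ℝ) {ψ : Site d → Fin d → Matrix n n ℂ} (hψ : IsSkewDir ψ) : IsSkewDir (h • ψ) :=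
  fun x μ => by simpa only [Pi.smul_apply] using skewAdjoint.smul_mem h (hψ x μ)

/-- **The perturbed configuration `p ↦ (V p)·e^{h·ψ p}` of a parametrised family is continuous on `S`** (product topology) when the background
`p ↦ V p` is and the direction is coordinatewise continuous. [folklore] -/
theorem continuousOn_vary_param {P : Type*} [TopologicalSpace P] {S : Set P} {V : P → (Site d → Fin d → (Matrix n n ℂ)ˣ)} (hV : ContinuousOn V S)
    {ψ : P → (Site d → Fin d → Matrix n n ℂ)} (hψ : ∀ (x : Site d) (μ : Fin d), ContinuousOn (fun p => ψ p x μ) S) (h : ℝ) :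
    ContinuousOn (fun p => vary (V p) (h • ψ p) 1) S := by
  refine continuousOn_pi.mpr fun x => continuousOn_pi.mpr fun μ => ?_
  have h1 : ContinuousOn (fun p => V p x μ) S := (continuous_eval x μ).comp_continuousOn hV
  have h2 : ContinuousOn (fun p => expUnit (((1 : ℝ) : ℂ) • (h • ψ p) x μ)) S := by
    refine continuous_expUnit.comp_continuousOn ?_
    simp only [Pi.smul_apply, Complex.ofReal_one, one_smul]
    exact (hψ x μ).const_smul h
  show ContinuousOn (fun p => V p x μ * expUnit (((1 : ℝ) : ℂ) • (h • ψ p) x μ)) S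
  exact h1.mul h2

/-! ## §2 The one-level sup bound of the push-forward on the class -/

/-- The averaged loop weight against a sup: `Σ_x L^{−d}‖(δ_ψU)(loop_{c,x})‖ ≤ (2dL + 2L)·s`. [folklore] -/
theorem loopAvg_le_sup [Nonempty n] {L : ℕ} (hL : 1 ≤ L) {U : Site d → Fin d → (Matrix n n ℂ)ˣ} (hU : IsUnitaryCfg U)
    {ψ : Site d → Fin d → Matrix n n ℂ} {s : ℝ} (hs : 0 ≤ s) (hψ : ∀ (x : Site d) (μ : Fin d), ‖ψ x μ‖ ≤ s) (q : Site d) (κ : Fin d) :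
    loopAvg L U ψ q κ ≤ (2 * d * L + 2 * L) * s := by
  have hL0 : (0 : ℝ) < (L : ℝ) ^ d := by
    have : (0 : ℝ) < L := by exact_mod_cast (show 0 < L by omega)
    positivity
  have hterm : ∀ r : Fin d → Fin L,
      ((L : ℝ) ^ d)⁻¹ * ‖AveragingDeficitTransport.dhol U ψ q (loopWord L κ (boxVec L r))‖ ≤ ((L : ℝ) ^ d)⁻¹ * ((2 * d * L + 2 * L) * s) := by
    intro r
    refine mul_le_mul_of_nonneg_left ?_ (by positivity)
    have h1 := norm_dhol_le hU ψ q (loopWord L κ (boxVec L r))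
    have h2 := lnorm_le_length_mul ψ hψ q (loopWord L κ (boxVec L r))
    have hlen : ((loopWord L κ (boxVec L r)).length : ℝ) ≤ 2 * d * L + 2 * L := by
      rw [length_loopWord]
      have := l1_boxVec_le L r
      have h' : ((2 * l1 (boxVec L r) + 2 * L : ℕ) : ℝ) ≤ ((2 * (d * L) + 2 * L : ℕ) : ℝ) := by exact_mod_cast (by omega)
      refine h'.trans (le_of_eq ?_)
      push_cast; ring
    exact (h1.trans h2).trans (mul_le_mul_of_nonneg_right hlen hs)
  calc loopAvg L U ψ q κ = ∑ r : Fin d → Fin L, ((L : ℝ) ^ d)⁻¹ * ‖AveragingDeficitTransport.dhol U ψ q (loopWord L κ (boxVec L r))‖ := rfl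
    _ ≤ ∑ _r : Fin d → Fin L, ((L : ℝ) ^ d)⁻¹ * ((2 * d * L + 2 * L) * s) := Finset.sum_le_sum fun r _ => hterm r
    _ = (2 * d * L + 2 * L) * s := by
        rw [Finset.sum_const, Finset.card_univ, nsmul_eq_mul]
        have hcard : ((Fintype.card (Fin d → Fin L) : ℕ) : ℝ) = (L : ℝ) ^ d := by
          rw [Fintype.card_fun, Fintype.card_fin, Fintype.card_fin]; push_cast; ring
        rw [hcard, ← mul_assoc, mul_inv_cancel₀ hL0.ne', one_mul]

/-- The straight side against a sup: `‖(δ_ψU)(Γ_c)‖ ≤ L·s`. [folklore] -/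
theorem norm_dhol_seg_le_sup {L : ℕ} {U : Site d → Fin d → (Matrix n n ℂ)ˣ} (hU : IsUnitaryCfg U) {ψ : Site d → Fin d → Matrix n n ℂ} {s : ℝ}
    (hψ : ∀ (x : Site d) (μ : Fin d), ‖ψ x μ‖ ≤ s) (q : Site d) (κ : Fin d) :
    ‖AveragingDeficitTransport.dhol U ψ q (seg κ L)‖ ≤ L * s := by
  have h1 := norm_dhol_le hU ψ q (seg κ L)
  have h2 := lnorm_le_length_mul ψ hψ q (seg κ (L : ℤ))
  rw [length_seg, Int.natAbs_natCast] at h2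
  exact h1.trans h2

/-- **`‖cpush L U ψ (c)‖ ≤ (64(d+1)L + L)·s`** for a unitary background of plaquette radius `a`, `512(d+1)(d+4)L²a ≤ 1`, and `‖ψ‖ ≤ s` everywhere:
`cpush = Ad_{V̄(c)⁻¹}(δV̄(c))` with `V̄(c)` unitary, `‖δV̄(c)‖ ≤ 32·Σ_x L^{−d}‖δ loop_{c,x}‖ + ‖δΓ_c‖` ([tree] `norm_sideDeriv_sub_lin_le`), each
`‖δΓ‖ ≤ |Γ|·s` ([tree] `norm_dhol_le`, `lnorm_le_length_mul`), `|loop_{c,x}| ≤ 2dL + 2L`, `|Γ_c| = L`. [folklore] -/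
theorem norm_cpush_le_sup [Nonempty n] {L : ℕ} (hL : 1 ≤ L) {U : Site d → Fin d → (Matrix n n ℂ)ˣ} (hU : IsUnitaryCfg U) {a : ℝ} (ha : 0 ≤ a)
    (h512 : 512 * (d + 1) * (d + 4) * (L : ℝ) ^ 2 * a ≤ 1) (hUa : SmallField U a) {ψ : Site d → Fin d → Matrix n n ℂ} {s : ℝ} (hs : 0 ≤ s)
    (hψ : ∀ (x : Site d) (μ : Fin d), ‖ψ x μ‖ ≤ s) (y : Site d) (κ : Fin d) :
    ‖cpush L U ψ y κ‖ ≤ (64 * ((d : ℝ) + 1) * L + L) * s := by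
  have hW32 : ∀ r : Fin d → Fin L, ‖((Wcx L U ((L : ℤ) • y) κ (boxVec L r) : (Matrix n n ℂ)ˣ) : Matrix n n ℂ) - 1‖ ≤ 1 / 32 :=
    fun r => norm_Wcx_sub_one_le_32 hL hU ha h512 hUa ((L : ℤ) • y) κ r
  have hW4 : ∀ r : Fin d → Fin L, ‖((Wcx L U ((L : ℤ) • y) κ (boxVec L r) : (Matrix n n ℂ)ˣ) : Matrix n n ℂ) - 1‖ ≤ 1 / 4 :=
    fun r => (hW32 r).trans (by norm_num)
  -- `Ad` by the unitary `V̄(c)⁻¹` is isometric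
  letI : CStarAlgebra (Matrix n n ℂ) := {}
  have hbu : (bavg L U ((L : ℤ) • y) κ)⁻¹ ∈ unitaryUnits (Matrix n n ℂ) :=
    (unitaryUnits (Matrix n n ℂ)).inv_mem (bavg_mem_unitaryUnits (𝔸 := Matrix n n ℂ) (V := U) (fun x μ => hU x μ) L ((L : ℤ) • y) κ hW4)
  have e0 : cpush L U ψ y κ = Ad (bavg L U ((L : ℤ) • y) κ)⁻¹ (sideDeriv L U ψ ((L : ℤ) • y) κ) := rfl
  rw [e0, norm_Ad_of_unitary hbu]
  have hside := (norm_sideDeriv_sub_lin_le L hL hU ψ ((L : ℤ) • y) κ (w := 1 / 32) le_rfl hW32).2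
  have hloop := loopAvg_le_sup hL hU hs hψ ((L : ℤ) • y) κ
  have hseg := norm_dhol_seg_le_sup (L := L) hU hψ ((L : ℤ) • y) κ
  calc ‖sideDeriv L U ψ ((L : ℤ) • y) κ‖
      ≤ 32 * loopAvg L U ψ ((L : ℤ) • y) κ + ‖AveragingDeficitTransport.dhol U ψ ((L : ℤ) • y) (seg κ L)‖ := hside
    _ ≤ 32 * ((2 * d * L + 2 * L) * s) + L * s := by gcongr
    _ = (64 * ((d : ℝ) + 1) * L + L) * s := by ring

/-! ## §3 One level: the push-forward of a parametrised family is continuous in the parameter -/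

/-- **ONE LEVEL.**  For a family of backgrounds `p ↦ V p` continuous on `S` into the product topology, unitary with `SmallField (V p) a`,
`1024(d+1)(d+4)L²a ≤ 1`, and a family of skew directions `p ↦ ψ p` coordinatewise continuous on `S` with `‖ψ p‖ ≤ s`: for every coarse bond
`(y, κ)` the push-forward `p ↦ cpush L (V p) (ψ p) y κ` is continuous on `S`.  See the module docstring for the mechanism. [folklore] -/
theorem continuousOn_cpush_param [Nonempty n] {P : Type*} [TopologicalSpace P] {S : Set P} {L : ℕ} (hL : 1 ≤ L) {a : ℝ} (ha : 0 ≤ a)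
    (hsmall : 1024 * (d + 1) * (d + 4) * (L : ℝ) ^ 2 * a ≤ 1)
    {V : P → (Site d → Fin d → (Matrix n n ℂ)ˣ)} (hV : ContinuousOn V S) (hVu : ∀ p ∈ S, IsUnitaryCfg (V p)) (hVa : ∀ p ∈ S, SmallField (V p) a)
    {ψ : P → (Site d → Fin d → Matrix n n ℂ)} (hψ : ∀ (x : Site d) (μ : Fin d), ContinuousOn (fun p => ψ p x μ) S)
    (hψs : ∀ p ∈ S, IsSkewDir (ψ p)) {s : ℝ} (hs : 0 ≤ s) (hψb : ∀ p ∈ S, ∀ (x : Site d) (μ : Fin d), ‖ψ p x μ‖ ≤ s)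
    (y : Site d) (κ : Fin d) :
    ContinuousOn (fun p => cpush L (V p) (ψ p) y κ) S := by
  have hL0 : (0 : ℝ) < L := by exact_mod_cast (show 0 < L by omega)
  have hd1 : (0 : ℝ) < (d : ℝ) + 1 := by positivity
  have hd4 : (0 : ℝ) < (d : ℝ) + 4 := by positivity
  have h512 : 512 * (d + 1) * (d + 4) * (L : ℝ) ^ 2 * a ≤ 1 := by nlinarith [mul_nonneg (mul_nonneg hd1.le hd4.le) (mul_nonneg (sq_nonneg (L : ℝ)) ha)]
  have hρ := rho0_pos (d := d) hL
  refine continuousOn_of_uniform_approx_of_continuousOn fun u hu => ?_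
  obtain ⟨ε, hε, hεu⟩ := Metric.mem_uniformity_dist.mp hu
  -- the step `h`: `h·s ≤ t := min(1, c₁∕2, ρ₀∕4)` and `2hs²∕ρ₀² < ε`
  set c₁ : ℝ := 1 / (4096 * ((d : ℝ) + 1) * ((d : ℝ) + 4) * (L : ℝ) ^ 2) with hc₁
  have hc₁0 : 0 < c₁ := by rw [hc₁]; positivity
  set t : ℝ := min (min 1 (c₁ / 2)) (rho0 d L / 4) with ht
  have ht0 : 0 < t := by rw [ht]; exact lt_min (lt_min one_pos (by positivity)) (by positivity)
  set h : ℝ := min (t / (s + 1)) (ε * rho0 d L ^ 2 / (2 * (2 * s ^ 2 + 1))) with hh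
  have hh0 : 0 < h := by rw [hh]; exact lt_min (by positivity) (by positivity)
  have hhs : h * s ≤ t := by
    have h1 : h ≤ t / (s + 1) := min_le_left _ _
    have h2 : t / (s + 1) * s ≤ t := by
      rw [div_mul_eq_mul_div, div_le_iff₀ (by positivity)]; nlinarith
    nlinarith
  have hhs1 : h * s ≤ 1 := hhs.trans ((min_le_left _ _).trans (min_le_left _ _))
  have hhsc : h * s ≤ c₁ / 2 := hhs.trans ((min_le_left _ _).trans (min_le_right _ _))
  have hhsr : h * s ≤ rho0 d L / 4 := hhs.trans (min_le_right _ _)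
  have hhs0 : 0 ≤ h * s := by positivity
  have herr : 2 * (h * s / rho0 d L) ^ 2 / h < ε := by
    have h1 : h ≤ ε * rho0 d L ^ 2 / (2 * (2 * s ^ 2 + 1)) := min_le_right _ _
    have e : 2 * (h * s / rho0 d L) ^ 2 / h = (2 * s ^ 2 / rho0 d L ^ 2) * h := by
      field_simp
    rw [e]
    calc 2 * s ^ 2 / rho0 d L ^ 2 * h ≤ 2 * s ^ 2 / rho0 d L ^ 2 * (ε * rho0 d L ^ 2 / (2 * (2 * s ^ 2 + 1))) :=
          mul_le_mul_of_nonneg_left h1 (by positivity)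
      _ = ε * (s ^ 2 / (2 * s ^ 2 + 1)) := by field_simp
      _ < ε * 1 := by
          refine mul_lt_mul_of_pos_left ?_ hε
          rw [div_lt_one (by positivity)]; nlinarith
      _ = ε := mul_one ε
  -- the direction `h·ψ p` and the perturbed family
  have hX : ∀ p ∈ S, ∀ (x : Site d) (μ : Fin d), ‖(h • ψ p) x μ‖ ≤ h * s := by
    intro p hp x μ
    rw [Pi.smul_apply, Pi.smul_apply, norm_smul, Real.norm_eq_abs, abs_of_pos hh0]
    exact mul_le_mul_of_nonneg_left (hψb p hp x μ) hh0.le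
  have hXs : ∀ p ∈ S, IsSkewDir (h • ψ p) := fun p hp => isSkewDir_smul h (hψs p hp)
  set a' : ℝ := a + 4 * (Real.exp (h * s) - 1) with ha'
  have ha'0 : 0 ≤ a' := by
    rw [ha']; have := Real.add_one_le_exp (h * s); nlinarith
  have h512' : 512 * (d + 1) * (d + 4) * (L : ℝ) ^ 2 * a' ≤ 1 := by
    have he : Real.exp (h * s) - 1 ≤ 2 * (h * s) := by
      have hb := Real.abs_exp_sub_one_sub_id_le (x := h * s) (by rw [abs_of_nonneg hhs0]; exact hhs1)
      have hb' := (abs_le.mp hb).2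
      nlinarith
    have hc : 512 * ((d : ℝ) + 1) * ((d : ℝ) + 4) * (L : ℝ) ^ 2 * (4 * c₁) = 1 / 2 := by
      rw [hc₁]; field_simp; ring
    have h4 : 4 * (Real.exp (h * s) - 1) ≤ 4 * c₁ := by linarith
    have hpos : 0 ≤ 512 * ((d : ℝ) + 1) * ((d : ℝ) + 4) * (L : ℝ) ^ 2 := by positivity
    rw [ha']
    nlinarith [mul_le_mul_of_nonneg_left h4 hpos]
  have hV'c : ContinuousOn (fun p => vary (V p) (h • ψ p) 1) S := continuousOn_vary_param hV hψ h
  have hV'u : ∀ p ∈ S, IsUnitaryCfg (vary (V p) (h • ψ p) 1) := fun p hp => vary_isUnitaryCfg (hVu p hp) (hXs p hp) 1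
  have hV'a : ∀ p ∈ S, SmallField (vary (V p) (h • ψ p) 1) a' := fun p hp =>
    smallField_vary (hVu p hp) (hVa p hp) (hXs p hp) (hX p hp)
  -- continuity of the two averaged bonds on `S`
  have hA : ContinuousOn (fun p => cavg L (V p) y κ) S := by
    have h1 := (continuousOn_rescale_bavg (d := d) (n := n) L hL ha h512).comp hV fun p hp => ⟨hVu p hp, hVa p hp⟩
    exact ((continuous_apply κ).comp (continuous_apply y)).comp_continuousOn h1
  have hB : ContinuousOn (fun p => cavg L (vary (V p) (h • ψ p) 1) y κ) S := by
    have h1 := (continuousOn_rescale_bavg (d := d) (n := n) L hL ha'0 h512').comp hV'c fun p hp => ⟨hV'u p hp, hV'a p hp⟩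
    exact ((continuous_apply κ).comp (continuous_apply y)).comp_continuousOn h1
  have hM : ContinuousOn (fun p => (((cavg L (V p) y κ)⁻¹ : (Matrix n n ℂ)ˣ) : Matrix n n ℂ) * ((cavg L (vary (V p) (h • ψ p) 1) y κ : (Matrix n n ℂ)ˣ) : Matrix n n ℂ)) S := by
    have h1 : ContinuousOn (fun p => (((cavg L (V p) y κ)⁻¹ : (Matrix n n ℂ)ˣ) : Matrix n n ℂ)) S := Units.continuous_coe_inv.comp_continuousOn hA
    have h2 : ContinuousOn (fun p => ((cavg L (vary (V p) (h • ψ p) 1) y κ : (Matrix n n ℂ)ˣ) : Matrix n n ℂ)) S :=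
      Units.continuous_val.comp_continuousOn hB
    exact h1.mul h2
  -- the approximant: the difference quotient at step `h`
  refine ⟨fun p => h⁻¹ • mlog ((((cavg L (V p) y κ)⁻¹ : (Matrix n n ℂ)ˣ) : Matrix n n ℂ) * ((cavg L (vary (V p) (h • ψ p) 1) y κ : (Matrix n n ℂ)ˣ) : Matrix n n ℂ)), ?_, ?_⟩
  · intro p hp
    have hq := (norm_relUnit_sub_one_le_quarter hL (hVu p hp) ha h512 (hVa p hp) (hX p hp) hhsr y κ).2
    have hm : ContinuousAt (mlog : Matrix n n ℂ → Matrix n n ℂ)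
        ((((cavg L (V p) y κ)⁻¹ : (Matrix n n ℂ)ˣ) : Matrix n n ℂ) * ((cavg L (vary (V p) (h • ψ p) 1) y κ : (Matrix n n ℂ)ˣ) : Matrix n n ℂ)) :=
      (analyticAt_mlog (lt_of_le_of_lt hq (by norm_num))).continuousAt
    have h3 : ContinuousWithinAt
        (fun p => mlog ((((cavg L (V p) y κ)⁻¹ : (Matrix n n ℂ)ˣ) : Matrix n n ℂ) * ((cavg L (vary (V p) (h • ψ p) 1) y κ : (Matrix n n ℂ)ˣ) : Matrix n n ℂ))) S p :=
      ContinuousAt.comp_continuousWithinAt (g := (mlog : Matrix n n ℂ → Matrix n n ℂ))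
        (f := fun p => (((cavg L (V p) y κ)⁻¹ : (Matrix n n ℂ)ˣ) : Matrix n n ℂ) * ((cavg L (vary (V p) (h • ψ p) 1) y κ : (Matrix n n ℂ)ˣ) : Matrix n n ℂ)) hm (hM p hp)
    exact h3.const_smul h⁻¹
  · intro p hp
    apply hεu
    rw [dist_eq_norm]
    have hW32 : ∀ r : Fin d → Fin L, ‖((Wcx L (V p) ((L : ℤ) • y) κ (boxVec L r) : (Matrix n n ℂ)ˣ) : Matrix n n ℂ) - 1‖ ≤ 1 / 32 :=
      fun r => norm_Wcx_sub_one_le_32 hL (hVu p hp) ha h512 (hVa p hp) ((L : ℤ) • y) κ r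
    have hlin : cpush L (V p) (h • ψ p) y κ = h • cpush L (V p) (ψ p) y κ := pushDir_smul L (V p) h (ψ p) ((L : ℤ) • y) κ hW32
    have hrem := norm_relStep_sub_cpush_le hL (hVu p hp) ha h512 (hVa p hp) hhs0 (hX p hp) hhsr y κ
    have e : cpush L (V p) (ψ p) y κ
        - h⁻¹ • mlog ((((cavg L (V p) y κ)⁻¹ : (Matrix n n ℂ)ˣ) : Matrix n n ℂ) * ((cavg L (vary (V p) (h • ψ p) 1) y κ : (Matrix n n ℂ)ˣ) : Matrix n n ℂ))
        = h⁻¹ • (cpush L (V p) (h • ψ p) y κ - relStep L (V p) (h • ψ p) y κ) := by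
      rw [hlin, smul_sub, smul_smul, inv_mul_cancel₀ hh0.ne', one_smul]
      rfl
    rw [e, norm_smul, Real.norm_eq_abs, abs_of_pos (inv_pos.mpr hh0), norm_sub_rev]
    calc h⁻¹ * ‖relStep L (V p) (h • ψ p) y κ - cpush L (V p) (h • ψ p) y κ‖ ≤ h⁻¹ * (2 * (h * s / rho0 d L) ^ 2) :=
          mul_le_mul_of_nonneg_left hrem (inv_pos.mpr hh0).le
      _ = 2 * (h * s / rho0 d L) ^ 2 / h := by rw [inv_mul_eq_div]
      _ < ε := herr

/-! ## §4 The tower: `p ↦ cpushIter L j (V p) (ψ p) (c)` is continuous on `S` -/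

omit [Fintype n] [DecidableEq n] in
/-- Every level of `LevelSmall` contains the doubled standard smallness `1024(d+1)(d+4)L²x ≤ 1` (room for the perturbation of §3). [folklore] -/
theorem small1024_of_levelSmall {L : ℕ} (hL : 1 ≤ L) {j : ℕ} {x : ℝ} (hx : 0 ≤ x) (hs : LevelSmall d L j x) :
    1024 * (d + 1) * (d + 4) * (L : ℝ) ^ 2 * x ≤ 1 := by
  have h2 := hs.two
  have hL1 : (1 : ℝ) ≤ L := by exact_mod_cast hL
  have hA : (4 : ℝ) ≤ ((d : ℝ) + 1) * ((d : ℝ) + 4) := by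
    have : (0 : ℝ) ≤ d := Nat.cast_nonneg d
    nlinarith
  have hLp : (1 : ℝ) ≤ (L : ℝ) ^ (d + 2) := one_le_pow₀ hL1
  have hfac : (1 : ℝ) ≤ 64 * (((d : ℝ) + 1) * ((d : ℝ) + 4)) * (L : ℝ) ^ (d + 2) := by nlinarith
  have hcmp : 1024 * ((d : ℝ) + 1) * ((d : ℝ) + 4) * (L : ℝ) ^ 2 ≤ AveragingDeficitTwoLevelPrep.twoLevelSmall d L := by
    unfold AveragingDeficitTwoLevelPrep.twoLevelSmall
    have e : (65536 : ℝ) * ((d : ℝ) + 1) ^ 2 * ((d : ℝ) + 4) ^ 2 * (L : ℝ) ^ (d + 4)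
        = (1024 * ((d : ℝ) + 1) * ((d : ℝ) + 4) * (L : ℝ) ^ 2) * (64 * (((d : ℝ) + 1) * ((d : ℝ) + 4)) * (L : ℝ) ^ (d + 2)) := by ring
    rw [e]
    exact le_mul_of_one_le_right (by positivity) hfac
  calc 1024 * ((d : ℝ) + 1) * ((d : ℝ) + 4) * (L : ℝ) ^ 2 * x ≤ AveragingDeficitTwoLevelPrep.twoLevelSmall d L * x :=
        mul_le_mul_of_nonneg_right hcmp hx
    _ ≤ 1 := h2

/-- **THE TOWER.**  For a family of backgrounds `p ↦ V p` continuous on `S`, unitary, `SmallField (V p) x` with `LevelSmall d L j x` (`L ≥ 2`), and a family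
of skew directions coordinatewise continuous on `S` with a uniform sup bound: `p ↦ cpushIter L j (V p) (ψ p) y κ` is continuous on `S` for every coarse
bond — induction on the tower, the next level's background `cavg L (V p)` being continuous on `S` ([tree] `continuousOn_rescale_bavg`) and its direction
`cpush L (V p) (ψ p)` continuous (§3), skew ([tree] `cpush_skew`) and uniformly bounded (§2). [folklore] -/
theorem continuousOn_cpushIter_param [Nonempty n] {P : Type*} [TopologicalSpace P] {S : Set P} {L : ℕ} (hL : 2 ≤ L) (j : ℕ) :
    ∀ {x : ℝ} {V : P → (Site d → Fin d → (Matrix n n ℂ)ˣ)} {ψ : P → (Site d → Fin d → Matrix n n ℂ)} {s : ℝ},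
      0 ≤ x → LevelSmall d L j x → ContinuousOn V S → (∀ p ∈ S, IsUnitaryCfg (V p)) → (∀ p ∈ S, SmallField (V p) x) →
      (∀ (z : Site d) (μ : Fin d), ContinuousOn (fun p => ψ p z μ) S) → (∀ p ∈ S, IsSkewDir (ψ p)) → 0 ≤ s →
      (∀ p ∈ S, ∀ (z : Site d) (μ : Fin d), ‖ψ p z μ‖ ≤ s) →
      ∀ (y : Site d) (κ : Fin d), ContinuousOn (fun p => cpushIter L j (V p) (ψ p) y κ) S := by
  have hL1 : 1 ≤ L := by omega
  induction j with
  | zero =>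
      intro x V ψ s hx hls hV hVu hVx hψ hψs hs hψb y κ
      exact continuousOn_cpush_param hL1 hx (small1024_of_levelSmall hL1 hx hls) hV hVu hVx hψ hψs hs hψb y κ
  | succ j ih =>
      intro x V ψ s hx hls hV hVu hVx hψ hψs hs hψb y κ
      have h512 : 512 * (d + 1) * (d + 4) * (L : ℝ) ^ 2 * x ≤ 1 := small512_of_levelSmall hL1 hx hls
      have h1024 := small1024_of_levelSmall hL1 hx hls
      have hV' : ContinuousOn (fun p => cavg L (V p)) S := by
        have h := (continuousOn_rescale_bavg (d := d) (n := n) L hL1 hx h512).comp hV fun p hp => ⟨hVu p hp, hVx p hp⟩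
        exact h
      have hnext : ∀ p ∈ S, IsUnitaryCfg (cavg L (V p)) ∧ SmallField (cavg L (V p)) (prop1Radius d L x) := fun p hp =>
        ⟨(next_level hL1 (hVu p hp) hx hls (hVx p hp)).1, (next_level hL1 (hVu p hp) hx hls (hVx p hp)).2.2.2⟩
      have hψ' : ∀ (z : Site d) (μ : Fin d), ContinuousOn (fun p => cpush L (V p) (ψ p) z μ) S := fun z μ =>
        continuousOn_cpush_param hL1 hx h1024 hV hVu hVx hψ hψs hs hψb z μ
      have hψ's : ∀ p ∈ S, IsSkewDir (cpush L (V p) (ψ p)) := fun p hp =>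
        NE3QuadRemainderTower.cpush_skew hL1 (hVu p hp) hx h512 (hVx p hp) (hψs p hp)
      have hC : 0 ≤ (64 * ((d : ℝ) + 1) * L + L) * s := by positivity
      have hψ'b : ∀ p ∈ S, ∀ (z : Site d) (μ : Fin d), ‖cpush L (V p) (ψ p) z μ‖ ≤ (64 * ((d : ℝ) + 1) * L + L) * s :=
        fun p hp z μ => norm_cpush_le_sup hL1 (hVu p hp) hx h512 (hVx p hp) hs (hψb p hp) z μ
      show ContinuousOn (fun p => cpushIter L j (cavg L (V p)) (cpush L (V p) (ψ p)) y κ) S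
      exact ih (AveragingDeficitMultiLevelPrep.prop1Radius_nonneg hx) hls.2 hV' (fun p hp => (hnext p hp).1) (fun p hp => (hnext p hp).2)
        hψ' hψ's hC hψ'b y κ

/-- **THE TOWER AT A FIXED DIRECTION, BACKGROUND AS THE VARIABLE**: on `{U | IsUnitaryCfg U ∧ SmallField U x}` with `LevelSmall d L j x` (`L ≥ 2`),
`U ↦ cpushIter L j U φ y κ` is continuous for every skew direction `φ` with a sup bound. [folklore] -/
theorem continuousOn_cpushIter [Nonempty n] {L : ℕ} (hL : 2 ≤ L) (j : ℕ) {x : ℝ} (hx : 0 ≤ x) (hls : LevelSmall d L j x)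
    {φ : Site d → Fin d → Matrix n n ℂ} (hφs : IsSkewDir φ) {s : ℝ} (hs : 0 ≤ s) (hφb : ∀ (z : Site d) (μ : Fin d), ‖φ z μ‖ ≤ s)
    (y : Site d) (κ : Fin d) :
    ContinuousOn (fun U : Site d → Fin d → (Matrix n n ℂ)ˣ => cpushIter L j U φ y κ) {U | IsUnitaryCfg U ∧ SmallField U x} :=
  continuousOn_cpushIter_param (S := {U : Site d → Fin d → (Matrix n n ℂ)ˣ | IsUnitaryCfg U ∧ SmallField U x})
    (V := fun U : Site d → Fin d → (Matrix n n ℂ)ˣ => U) (ψ := fun _ => φ) hL j hx hls continuousOn_id (fun _ hU => hU.1) (fun _ hU => hU.2)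
    (fun _ _ => continuousOn_const) (fun _ _ => hφs) hs (fun _ _ => hφb) y κ

end

end Summit.QuantumFields.BalabanUV.T4Continuum.NE7PushForwardContinuity
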